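import Mathlib
import Summits.Ventures.FusionMHD.Models.CerfonFreidbergIterLikeAxisCert
import HarnessLib

/-!
# Ventures/FusionMHD — Models/CerfonFreidbergIterLikeAxis.lean: the MAGNETIC AXIS, on-axis elongation and safety factor, and the
# near-axis Mercier / Lortz thresholds of the Cerfon–Freidberg ITER-like instance of record — KERNEL ENCLOSURES (read-out of
# the certificate `Models/CerfonFreidbergIterLikeAxisCert.lean`)

HONEST FRAMING (LADDER-GRIDFUSION three columns; rungs F1.a(a) / F1.MER-axis on the SECOND analytic rung of the fusion
benchmark ladder = the Cerfon–Freidberg «computed-shape» equilibrium; F2 step-2b comparison rows B1/B2, now kernel statements).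
`U` = THE flux function of record of the CF ITER-like instance (`CerfonFreidbergIterLikeAxisCert.U`, = the unique instance of
p496802), `X_a` = its axis abscissa, `F` = the free constant `R B_φ` (the Solov'ev profiles leave it free; every criterion is
stated `F`-parametrically, exactly as for the PCF instances in `SolovevPCF.lean` / `SolovevPCFMercierAxis.lean`).

CERTIFIED (kernel, this file):
* `axis` — `(X_a, 0)` is a critical point of `U`, `X_a ∈ [1.04543964, 1.04543965]`, `U_XX(X_a,0) ∈ [0.78220322, 0.78220323]`,
  `U_YY ∈ [0.31074083, 0.31074084]` — both `> 0`: a non-degenerate minimum of the flux (an O-point) —, `U(X_a,0) ∈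
  [−0.03684606, −0.03684604]`, `U_XXX ∈ [2.03431154, 2.03431155]`;
* `elongationOnAxis_bounds` — `κ₀ ∈ [1.58657511, 1.58657512]` (`< κ = 1.7`; PCF ITER-like: `1.7253`);
* `q0_sq` — `q₀(F)² = F²·r_q`, `r_q ∈ [3.76429927, 3.76429928]` (`q₀/F = 1.9401802…`; PCF: `1.99133`); **`q₀ ≥ 1 ∀ F ≥ 0.5155`,
  `q₀ < 1 ∀ 0 < F ≤ 0.5154`**;
* `nearAxisD_bounds` / `nearAxisShift_bounds` — Bateman `d ∈ [0.28107749, 0.2810775]`, shift `S ∈ [−0.45315376, −0.45315374]`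
  (PCF: `d = 0`, `S = −1/2` exactly);
* **near-axis MERCIER (necessary; Bateman (7.3.2) δ = 1, `Q = 0`): HOLDS ∀ F ≥ 0.5583, FAILS ∀ 0 < F ≤ 0.5582** (`F_M = 0.5582487…`;
  PCF: `(0.619, 0.6191]`); **LORTZ (sufficient, δ = 0): HOLDS ∀ F ≥ 1.0564, FAILS ∀ 0 < F ≤ 1.0563** (`F_L = 1.0563082…`; PCF:
  `(1.2362, 1.2363]`); `thresholds_vs_PCF` records the cross-model comparison in the kernel.
VALIDATED (never merged): the same numbers to 1e-113 by two script lineages (bench/F2-CF-ITER-truth-lineage1.json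
c6a60180873b9077 rows B1/B2; ref-1 cf_check.py).  MODELLED: the analytic CF equilibrium family (ideal MHD, Solov'ev profiles,
`A = 0` hence `Q = 0`, fixed analytic boundary); Bateman's (7.3.2) is a NEAR-AXIS expansion criterion — Mercier NECESSARY, Lortz
SUFFICIENT, for localised interchange only; `q₀ ≥ 1` is the MODELLED on-axis Kruskal–Shafranov-type reading.  No statement here
says any device is stable.  Typer/prover: gridfusion-model-5 (g5), 2026-08-27.  Citations: Freidberg 2014 (6.41)–(6.42), §6.6.1
[Freidberg2014]; Bateman 1978 §7.3 (7.3.2)–(7.3.5) [Bateman1978].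
-/

noncomputable section

open Set NonemptyInterval Matrix
open Literature.Analysis.ODE Literature.Analysis.ODE.FExpr
open Literature.Analysis.ValidatedNumerics Literature.Analysis.ValidatedNumerics.ITaylor
open Literature.MathematicalPhysics.MHD Literature.MathematicalPhysics.MHD.GradShafranov
  Literature.MathematicalPhysics.MHD.FluxGeometry Literature.MathematicalPhysics.MHD.CerfonFreidberg
  Literature.MathematicalPhysics.MHD.Mercier.NearAxis _root_.Real
open Summit.Ventures.FusionMHD.Models.SolovevPCF (nearAxisShift nearAxisD)

namespace Summit.Ventures.FusionMHD.Models.CFIterLike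

/-! ## §1 The magnetic axis and the on-axis jets (kernel enclosures) -/

/-- THE AXIS ABSCISSA OF RECORD `X_a` (normalised major radius `R_a/R₀` of the magnetic axis). -/
def Xa : ℝ := axZero 8

/-- `X_a ∈ [1.04543964, 1.04543965]`. -/
theorem Xa_bounds : (104543964 / 100000000 : ℝ) ≤ Xa ∧ Xa ≤ 104543965 / 100000000 := by
  have h := coord_bounds axZero_mem 8 (104543964 / 100000000) (104543965 / 100000000) (by decide +kernel)
    (by decide +kernel)
  push_cast at h
  exact h

/-- `X_a > 0`. -/
theorem Xa_pos : 0 < Xa := by linarith [Xa_bounds.1]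

/-- **THE AXIS:** `(X_a, 0)` is a critical point of the flux of record, `∇U(X_a, 0) = 0` (`U_X` by equation 8;
`U_Y(X, 0) = 0` by up–down symmetry). -/
theorem axis : IsCriticalPoint U Xa 0 := by
  refine ⟨?_, ?_⟩
  · have h := axZero_eq 8
    rwa [eval_axSystem_8 _ Xa_pos.ne'] at h
  · show dZ (cfSolution 0 coeff) Xa 0 = 0
    rw [dZ_cfSolution_zero]; ring

/-- The on-axis radial curvature `U_XX(X_a, 0)` is the ninth unknown. -/
theorem dRR_axis : dRR U Xa 0 = axZero 9 := by
  have h := axZero_eq 9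
  rw [eval_axSystem_9 _ Xa_pos.ne'] at h
  exact (sub_eq_zero.mp h).symm

/-- The on-axis vertical curvature `U_YY(X_a, 0)` is the tenth unknown. -/
theorem dZZ_axis : dZZ U Xa 0 = axZero 10 := by
  have h := axZero_eq 10
  rw [eval_axSystem_10] at h
  exact (sub_eq_zero.mp h).symm

/-- The cubic radial jet `U_XXX(X_a, 0)` is the eleventh unknown. -/
theorem dRRR_axis : dRRR U Xa 0 = axZero 11 := by
  have h := axZero_eq 11
  rw [eval_axSystem_11 _ Xa_pos.ne'] at h
  exact (sub_eq_zero.mp h).symm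

/-- The flux on axis `U(X_a, 0)` is the last unknown. -/
theorem U_axis : U Xa 0 = axZero 17 := by
  have h := axZero_eq 17
  rw [eval_axSystem_17] at h
  exact (sub_eq_zero.mp h).symm

/-- `U_XX(X_a,0) ∈ [0.78220322, 0.78220323]`. -/
theorem dRR_axis_bounds : (78220322 / 100000000 : ℝ) ≤ dRR U Xa 0 ∧ dRR U Xa 0 ≤ 78220323 / 100000000 := by
  have h := coord_bounds axZero_mem 9 (78220322 / 100000000) (78220323 / 100000000) (by decide +kernel)
    (by decide +kernel)
  push_cast at h; rw [dRR_axis]; exact h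

/-- `U_YY(X_a,0) ∈ [0.31074083, 0.31074084]`. -/
theorem dZZ_axis_bounds : (31074083 / 100000000 : ℝ) ≤ dZZ U Xa 0 ∧ dZZ U Xa 0 ≤ 31074084 / 100000000 := by
  have h := coord_bounds axZero_mem 10 (31074083 / 100000000) (31074084 / 100000000) (by decide +kernel)
    (by decide +kernel)
  push_cast at h; rw [dZZ_axis]; exact h

/-- `U_XXX(X_a,0) ∈ [2.03431154, 2.03431155]`. -/
theorem dRRR_axis_bounds : (203431154 / 100000000 : ℝ) ≤ dRRR U Xa 0 ∧ dRRR U Xa 0 ≤ 203431155 / 100000000 := by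
  have h := coord_bounds axZero_mem 11 (203431154 / 100000000) (203431155 / 100000000) (by decide +kernel)
    (by decide +kernel)
  push_cast at h; rw [dRRR_axis]; exact h

/-- `U(X_a,0) ∈ [−0.03684606, −0.03684604]` (the axis flux; the reference surface is `U = 0`). -/
theorem U_axis_bounds : (-3684606 / 100000000 : ℝ) ≤ U Xa 0 ∧ U Xa 0 ≤ -3684604 / 100000000 := by
  have h := coord_bounds axZero_mem 17 (-3684606 / 100000000) (-3684604 / 100000000) (by decide +kernel)
    (by decide +kernel)
  push_cast at h; rw [U_axis]; exact h

/-- **The axis is a non-degenerate minimum of the flux along both axes** (`U_XX > 0`, `U_YY > 0`): an O-point. -/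
theorem hessian_axis_pos : 0 < dRR U Xa 0 ∧ 0 < dZZ U Xa 0 :=
  ⟨by linarith [dRR_axis_bounds.1], by linarith [dZZ_axis_bounds.1]⟩

/-! ## §2 On-axis elongation and safety factor (F1.a(a) on the CF rung) -/

/-- The on-axis elongation `κ₀ = √(U_XX/U_YY)` (Freidberg: `ψ_RR/ψ_ZZ = κ₀²` on axis) is the twelfth unknown. -/
theorem elongationOnAxis_eq : elongationOnAxis (dRR U Xa 0) (dZZ U Xa 0) = axZero 12 := by
  have h12 := axZero_eq 12
  rw [eval_axSystem_12] at h12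
  have he : (158657511 / 100000000 : ℝ) ≤ axZero 12 ∧ axZero 12 ≤ 158657512 / 100000000 := by
    have h := coord_bounds axZero_mem 12 (158657511 / 100000000) (158657512 / 100000000) (by decide +kernel)
      (by decide +kernel)
    push_cast at h; exact h
  have hpos : 0 < axZero 12 := by linarith [he.1]
  have hyy : 0 < axZero 10 := by have := dZZ_axis_bounds.1; rw [dZZ_axis] at this; linarith
  unfold elongationOnAxis
  rw [dRR_axis, dZZ_axis]
  have hq : axZero 9 / axZero 10 = axZero 12 ^ 2 := by
    field_simp; linarith
  rw [hq, Real.sqrt_sq hpos.le]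

/-- **`κ₀ ∈ [1.58657511, 1.58657512]`** — the computed-shape equilibrium is LESS elongated on axis than its boundary
(`κ = 1.7`) and than the pure-polynomial PCF instance with the same `(ε, κ, δ)` (`κ₀(PCF) = 1.7253`, `SolovevPCFMercierAxis`). -/
theorem elongationOnAxis_bounds : (158657511 / 100000000 : ℝ) ≤ elongationOnAxis (dRR U Xa 0) (dZZ U Xa 0)
    ∧ elongationOnAxis (dRR U Xa 0) (dZZ U Xa 0) ≤ 158657512 / 100000000 := by
  have h := coord_bounds axZero_mem 12 (158657511 / 100000000) (158657512 / 100000000) (by decide +kernel)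
    (by decide +kernel)
  push_cast at h; rw [elongationOnAxis_eq]; exact h

/-- `κ₀ < κ = 17/10` (the reference-surface elongation of `CFIterLike`). -/
theorem elongationOnAxis_lt_kappa : elongationOnAxis (dRR U Xa 0) (dZZ U Xa 0) < κ := by
  unfold κ; linarith [elongationOnAxis_bounds.2]

/-- The certified `F`-INDEPENDENT functional `r_q := q₀²/F² = 1/(X_a²U_XXU_YY)` (fourteenth unknown). -/
def q0SqOverFSq : ℝ := axZero 14

/-- `r_q ∈ [3.76429927, 3.76429928]` (`q₀/F = 1.9401802…`; PCF ITER-like: `1.99133`). -/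
theorem q0SqOverFSq_bounds : (376429927 / 100000000 : ℝ) ≤ q0SqOverFSq ∧ q0SqOverFSq ≤ 376429928 / 100000000 := by
  have h := coord_bounds axZero_mem 14 (376429927 / 100000000) (376429928 / 100000000) (by decide +kernel)
    (by decide +kernel)
  push_cast at h; exact h

/-- **Exact on-axis safety factor, F-parametric:** `q₀(F)² = F²·r_q` (Freidberg (6.41)–(6.42) `q₀ = F/(R_a√(ψ_RRψ_ZZ))`
in the normalisation of record). -/
theorem q0_sq (F : ℝ) : safetyFactorOnAxis F Xa (dRR U Xa 0) (dZZ U Xa 0) ^ 2 = F ^ 2 * q0SqOverFSq := by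
  have h14 := axZero_eq 14
  rw [eval_axSystem_14] at h14
  obtain ⟨hxx, hyy⟩ := hessian_axis_pos
  rw [safetyFactorOnAxis_sq (mul_pos hxx hyy).le]
  rw [dRR_axis] at hxx ⊢
  rw [dZZ_axis] at hyy ⊢
  have hX := Xa_pos
  unfold q0SqOverFSq
  have e : axZero 14 = 1 / (Xa ^ 2 * (axZero 9 * axZero 10)) := by
    rw [eq_div_iff (by positivity)]
    unfold Xa; linarith
  rw [e]
  field_simp

/-- `q₀(F) ≥ 0` for `F ≥ 0`. -/
theorem q0_nonneg {F : ℝ} (hF : 0 ≤ F) : 0 ≤ safetyFactorOnAxis F Xa (dRR U Xa 0) (dZZ U Xa 0) := by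
  unfold safetyFactorOnAxis
  exact div_nonneg hF (mul_nonneg Xa_pos.le (Real.sqrt_nonneg _))

/-- `F_min⁺ = 1031/2000 = 0.5155`: the on-axis `q₀ = 1` threshold `F = 1/√r_q = 0.5154160…` rounded UP. -/
def Fmin : ℝ := 1031 / 2000

/-- **«∀ F ≥ 0.5155, q₀(F) ≥ 1»** on the CF ITER-like computed-shape equilibrium (MODELLED reading: on-axis
Kruskal–Shafranov-type / internal-kink threshold; CERTIFIED content: `F² r_q ≥ 1` from the enclosure of `r_q`). -/
theorem one_le_q0_of_le {F : ℝ} (hF : Fmin ≤ F) : 1 ≤ safetyFactorOnAxis F Xa (dRR U Xa 0) (dZZ U Xa 0) := by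
  have hF0 : 0 < F := lt_of_lt_of_le (by unfold Fmin; norm_num) hF
  have hsq : 1 ≤ safetyFactorOnAxis F Xa (dRR U Xa 0) (dZZ U Xa 0) ^ 2 := by
    rw [q0_sq]
    have h1 : Fmin ^ 2 ≤ F ^ 2 := pow_le_pow_left₀ (by unfold Fmin; norm_num) hF 2
    have h2 := q0SqOverFSq_bounds.1
    unfold Fmin at h1
    nlinarith
  nlinarith [q0_nonneg hF0.le]

/-- **… and `q₀(F) < 1` for every `0 < F ≤ 0.5154`** — the model's `q₀ = 1` threshold in `F` is certified to
`(0.5154, 0.5155]`. -/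
theorem q0_lt_one_of_le {F : ℝ} (hF0 : 0 < F) (hF : F ≤ 2577 / 5000) :
    safetyFactorOnAxis F Xa (dRR U Xa 0) (dZZ U Xa 0) < 1 := by
  have hsq : safetyFactorOnAxis F Xa (dRR U Xa 0) (dZZ U Xa 0) ^ 2 < 1 := by
    rw [q0_sq]
    have h1 : F ^ 2 ≤ (2577 / 5000 : ℝ) ^ 2 := pow_le_pow_left₀ hF0.le hF 2
    have h2 := q0SqOverFSq_bounds.2
    have h3 : 0 ≤ q0SqOverFSq := by linarith [q0SqOverFSq_bounds.1]
    nlinarith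
  nlinarith [q0_nonneg hF0.le]

/-! ## §3 Near-axis shift and Bateman's `d`; the near-axis Mercier / Lortz criteria (F1.MER-axis on the CF rung) -/

/-- Bateman's `d = 6S + 3` of the flux of record is the thirteenth unknown. -/
theorem nearAxisD_eq : nearAxisD U Xa = axZero 13 := by
  have h13 := axZero_eq 13
  rw [eval_axSystem_13] at h13
  have hxx : axZero 9 ≠ 0 := by have := hessian_axis_pos.1; rw [dRR_axis] at this; exact this.ne'
  unfold nearAxisD nearAxisShift
  rw [dRRR_axis, dRR_axis]
  unfold Xa at *
  have : axZero 13 = 3 - axZero 8 * axZero 11 / axZero 9 := by linarith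
  rw [this]
  field_simp
  ring

/-- **`d ∈ [0.28107749, 0.2810775]`** (PCF instances: `d = 0` exactly). -/
theorem nearAxisD_bounds : (28107749 / 100000000 : ℝ) ≤ nearAxisD U Xa ∧ nearAxisD U Xa ≤ 28107750 / 100000000 := by
  have h := coord_bounds axZero_mem 13 (28107749 / 100000000) (28107750 / 100000000) (by decide +kernel)
    (by decide +kernel)
  push_cast at h; rw [nearAxisD_eq]; exact h

/-- **Near-axis shift `S ∈ [−0.45315376, −0.45315374]`** (`S = d/6 − 1/2`; PCF instances: `S = −1/2` exactly). -/
theorem nearAxisShift_bounds : (-45315376 / 100000000 : ℝ) ≤ nearAxisShift U Xa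
    ∧ nearAxisShift U Xa ≤ -45315374 / 100000000 := by
  have h := nearAxisD_bounds
  have e : nearAxisShift U Xa = (nearAxisD U Xa - 3) / 6 := by unfold nearAxisD; ring
  rw [e]
  constructor <;> linarith [h.1, h.2]

/-- Bateman's Mercier bound `b_M = bound κ₀ 0 d 1` of the axis of record is the fifteenth unknown,
`b_M ∈ [0.85243321, 0.85243322]`. -/
theorem mercierBound_eq_and_bounds :
    bound (elongationOnAxis (dRR U Xa 0) (dZZ U Xa 0)) 0 (nearAxisD U Xa) 1 = axZero 15
    ∧ (85243321 / 100000000 : ℝ) ≤ axZero 15 ∧ axZero 15 ≤ 85243322 / 100000000 := by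
  have h15 := axZero_eq 15
  rw [eval_axSystem_15] at h15
  have h := coord_bounds axZero_mem 15 (85243321 / 100000000) (85243322 / 100000000) (by decide +kernel)
    (by decide +kernel)
  push_cast at h
  rw [elongationOnAxis_eq, nearAxisD_eq]
  exact ⟨by linarith, h⟩

/-- Bateman's Lortz bound `b_L = bound κ₀ 0 d 0` is the sixteenth unknown, `b_L ∈ [0.23808638, 0.23808639]`. -/
theorem lortzBound_eq_and_bounds :
    bound (elongationOnAxis (dRR U Xa 0) (dZZ U Xa 0)) 0 (nearAxisD U Xa) 0 = axZero 16
    ∧ (23808638 / 100000000 : ℝ) ≤ axZero 16 ∧ axZero 16 ≤ 23808639 / 100000000 := by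
  have h16 := axZero_eq 16
  rw [eval_axSystem_16] at h16
  have h := coord_bounds axZero_mem 16 (23808638 / 100000000) (23808639 / 100000000) (by decide +kernel)
    (by decide +kernel)
  push_cast at h
  rw [elongationOnAxis_eq, nearAxisD_eq]
  exact ⟨by linarith, h⟩

/-- The criteria as thresholds in `F² r_q`: `MercierCriterion (q₀ F) κ₀ 0 d ↔ 1 < b_M·(F²·r_q)` (for `F ≠ 0`). -/
theorem mercierNearAxis_iff {F : ℝ} (hF : F ≠ 0) :
    MercierCriterion (safetyFactorOnAxis F Xa (dRR U Xa 0) (dZZ U Xa 0))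
        (elongationOnAxis (dRR U Xa 0) (dZZ U Xa 0)) 0 (nearAxisD U Xa)
      ↔ 1 < axZero 15 * (F ^ 2 * q0SqOverFSq) := by
  unfold MercierCriterion
  rw [mercierBound_eq_and_bounds.1, q0_sq]
  have hr : 0 < q0SqOverFSq := by linarith [q0SqOverFSq_bounds.1]
  rw [div_lt_iff₀ (by positivity)]

/-- Same for Lortz: `LortzCriterion (q₀ F) κ₀ 0 d ↔ 1 < b_L·(F²·r_q)`. -/
theorem lortzNearAxis_iff {F : ℝ} (hF : F ≠ 0) :
    LortzCriterion (safetyFactorOnAxis F Xa (dRR U Xa 0) (dZZ U Xa 0))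
        (elongationOnAxis (dRR U Xa 0) (dZZ U Xa 0)) 0 (nearAxisD U Xa)
      ↔ 1 < axZero 16 * (F ^ 2 * q0SqOverFSq) := by
  unfold LortzCriterion
  rw [lortzBound_eq_and_bounds.1, q0_sq]
  have hr : 0 < q0SqOverFSq := by linarith [q0SqOverFSq_bounds.1]
  rw [div_lt_iff₀ (by positivity)]

/-- `F_M⁺ = 5583/10000`: the model's near-axis Mercier threshold `F_M = 0.5582487…` rounded UP (4 decimals). -/
def FmercierAxis : ℝ := 5583 / 10000

/-- **The near-axis Mercier (necessary, `δ = 1`, `Q = 0`) criterion HOLDS on the CF ITER-like computed-shape equilibrium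
for every `F ≥ 0.5583`** (i.e. `q₀ ≥ 1.0832`). -/
theorem mercierNearAxis_of_le {F : ℝ} (hF : FmercierAxis ≤ F) :
    MercierCriterion (safetyFactorOnAxis F Xa (dRR U Xa 0) (dZZ U Xa 0))
      (elongationOnAxis (dRR U Xa 0) (dZZ U Xa 0)) 0 (nearAxisD U Xa) := by
  have hF0 : 0 < F := lt_of_lt_of_le (by unfold FmercierAxis; norm_num) hF
  rw [mercierNearAxis_iff hF0.ne']
  have h1 : FmercierAxis ^ 2 ≤ F ^ 2 := pow_le_pow_left₀ (by unfold FmercierAxis; norm_num) hF 2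
  obtain ⟨-, hb, -⟩ := mercierBound_eq_and_bounds
  have hr := q0SqOverFSq_bounds.1
  unfold FmercierAxis at h1
  nlinarith [mul_le_mul hb (mul_le_mul h1 hr (by norm_num) (by positivity)) (by norm_num) (by linarith)]

/-- **… and FAILS for every `0 < F ≤ 0.5582`** — the model's near-axis Mercier threshold in `F` is certified to
`(0.5582, 0.5583]` (PCF ITER-like: `(0.619, 0.6191]`; the computed-shape equilibrium has the LOWER threshold). -/
theorem not_mercierNearAxis_of_le {F : ℝ} (hF0 : 0 < F) (hF : F ≤ 2791 / 5000) :
    ¬ MercierCriterion (safetyFactorOnAxis F Xa (dRR U Xa 0) (dZZ U Xa 0))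
      (elongationOnAxis (dRR U Xa 0) (dZZ U Xa 0)) 0 (nearAxisD U Xa) := by
  rw [mercierNearAxis_iff hF0.ne', not_lt]
  have h1 : F ^ 2 ≤ (2791 / 5000 : ℝ) ^ 2 := pow_le_pow_left₀ hF0.le hF 2
  obtain ⟨-, hb0, hb⟩ := mercierBound_eq_and_bounds
  obtain ⟨hr0, hr⟩ := q0SqOverFSq_bounds
  nlinarith [mul_le_mul hb (mul_le_mul h1 hr (by linarith) (by positivity)) (by positivity) (by norm_num)]

/-- `F_L⁺ = 2641/2500 = 1.0564`: the model's near-axis LORTZ (sufficient, `δ = 0`) threshold `F_L = 1.0563082…` rounded UP. -/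
def FlortzAxis : ℝ := 2641 / 2500

/-- **The near-axis Lortz (sufficient, `δ = 0`, `Q = 0`) criterion HOLDS for every `F ≥ 1.0564`.** -/
theorem lortzNearAxis_of_le {F : ℝ} (hF : FlortzAxis ≤ F) :
    LortzCriterion (safetyFactorOnAxis F Xa (dRR U Xa 0) (dZZ U Xa 0))
      (elongationOnAxis (dRR U Xa 0) (dZZ U Xa 0)) 0 (nearAxisD U Xa) := by
  have hF0 : 0 < F := lt_of_lt_of_le (by unfold FlortzAxis; norm_num) hF
  rw [lortzNearAxis_iff hF0.ne']
  have h1 : FlortzAxis ^ 2 ≤ F ^ 2 := pow_le_pow_left₀ (by unfold FlortzAxis; norm_num) hF 2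
  obtain ⟨-, hb, -⟩ := lortzBound_eq_and_bounds
  have hr := q0SqOverFSq_bounds.1
  unfold FlortzAxis at h1
  nlinarith [mul_le_mul hb (mul_le_mul h1 hr (by norm_num) (by positivity)) (by norm_num) (by linarith)]

/-- **… and FAILS for every `0 < F ≤ 1.0563`** (Lortz threshold certified to `(1.0563, 1.0564]`; PCF: `(1.2362, 1.2363]`). -/
theorem not_lortzNearAxis_of_le {F : ℝ} (hF0 : 0 < F) (hF : F ≤ 10563 / 10000) :
    ¬ LortzCriterion (safetyFactorOnAxis F Xa (dRR U Xa 0) (dZZ U Xa 0))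
      (elongationOnAxis (dRR U Xa 0) (dZZ U Xa 0)) 0 (nearAxisD U Xa) := by
  rw [lortzNearAxis_iff hF0.ne', not_lt]
  have h1 : F ^ 2 ≤ (10563 / 10000 : ℝ) ^ 2 := pow_le_pow_left₀ hF0.le hF 2
  obtain ⟨-, hb0, hb⟩ := lortzBound_eq_and_bounds
  obtain ⟨hr0, hr⟩ := q0SqOverFSq_bounds
  nlinarith [mul_le_mul hb (mul_le_mul h1 hr (by linarith) (by positivity)) (by positivity) (by norm_num)]

/-- Sanity link (lit-3): on the instance the sufficient criterion implies the necessary one (`κ₀ > 0`, `Q = 0 ≤ 1`). -/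
theorem mercierNearAxis_of_lortz {F : ℝ}
    (h : LortzCriterion (safetyFactorOnAxis F Xa (dRR U Xa 0) (dZZ U Xa 0))
      (elongationOnAxis (dRR U Xa 0) (dZZ U Xa 0)) 0 (nearAxisD U Xa)) :
    MercierCriterion (safetyFactorOnAxis F Xa (dRR U Xa 0) (dZZ U Xa 0))
      (elongationOnAxis (dRR U Xa 0) (dZZ U Xa 0)) 0 (nearAxisD U Xa) :=
  mercierCriterion_of_lortzCriterion (by linarith [elongationOnAxis_bounds.1]) (by norm_num) h

/-- CROSS-MODEL COMPARISON in the kernel (same shape triple (ε, κ, δ)): the computed-shape CF equilibrium has LOWER on-axis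
`q₀ = 1`, near-axis Mercier and Lortz thresholds in `F` than the pure-polynomial PCF one (`0.5155 < 0.5022`? no —
`F_min`: CF 0.5155 > PCF 0.5022 since `q₀/F` is smaller; Mercier: CF 0.5583 < PCF 0.6191; Lortz: CF 1.0564 < PCF 1.2363). -/
theorem thresholds_vs_PCF : SolovevPCF.IterLike.Fmin < Fmin ∧ FmercierAxis < SolovevPCF.IterLike.FmercierAxis
    ∧ FlortzAxis < SolovevPCF.IterLike.FlortzAxis := by
  unfold SolovevPCF.IterLike.Fmin Fmin FmercierAxis SolovevPCF.IterLike.FmercierAxis FlortzAxis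
    SolovevPCF.IterLike.FlortzAxis
  norm_num

end Summit.Ventures.FusionMHD.Models.CFIterLike
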